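import Mathlib
import HarnessLib
import Summits.NavierStokesRegularity.NavierStokesRegularity.Theorems.TaylorModelRungThreeCertificateCompact

/-!
# Crux K1b-DR (stmt-NavierStokesRegularity-23954), line `taylor-model` — COMPILED replay (`native_decide`) of the
# expanded compact toy: the v2 pipeline end-to-end

COMPUTATIONAL file (dss_28: `native_decide` admissible for certificate CHUNKS of this crux; the soundness theorems it
feeds are ordinary kernel proofs). `toy3_checkChain : toy3.expand.checkChain = true` is evaluated by compiled code
(`Lean.ofReduceBool` — DISCLOSED: this theorem and `toy3_chain` below depend on the axioms `propext`, `Classical.choice`,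
`Quot.sound` AND `Lean.ofReduceBool`/`Lean.trustCompiler`), then `toy3_chain : (toy3.expand.toCertData QS2.toRealHom).Chain`
follows from `chain_of_checks` with the three kernel-checked Booleans of `…CertificateCompact`. This is the v2 pipeline
of K-SIZE-23954 / dss_42 (compact tables → Lean-side expansion → compiled checker → kernel soundness) on the toy; the
real certificate's chunks `Data_j` will have exactly this shape. MODEL-lattice rung TL-M3; nothing here is a statement
about the Navier–Stokes equations.
-/

-- the sub-problem namespace repeats the summit name by design (D-0017)
set_option linter.dupNamespace false

namespace Summit.NavierStokesRegularity.NavierStokesRegularity.Theorems.TaylorModelCert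

open Literature.Analysis.FluidPDE.TaoCascade Literature.Analysis.FluidPDE.TaoCascade.TaylorChain

/-- COMPILED evaluation of the `Chain` checker on the expanded compact toy (uses `Lean.ofReduceBool`). [folklore] -/
theorem toy3_checkChain : toy3.expand.checkChain = true := by native_decide

/-- **End-to-end through the v2 pipeline**: `Chain` for the expanded compact toy (depends on `Lean.ofReduceBool` through
`toy3_checkChain`; everything else kernel-checked). [folklore] -/
theorem toy3_chain : (toy3.expand.toCertData QS2.toRealHom).Chain :=
  toy3.expand.chain_of_checks QS2.toRealHom_monotone (toy3.expand.coefOK_of_checkCoef toy3_checkCoef) toy2Entry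
    toy3_checkChain toy3_checkPolyTails toy3_checkEntry

end Summit.NavierStokesRegularity.NavierStokesRegularity.Theorems.TaylorModelCert
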